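import Summits.CriticalPhenomena.PercolationContinuityZ3.Theorems.PercNearOneGluingNoHeavyLowerTailTwoPortPeelingHub
import HarnessLib

/-!
# `NoHeavyLowerTail` (stmt-CriticalPhenomena-4575) — two-port peeling: level-`≤ 2` translation of the glued events

Route `PercNearOneGluingNoHeavy`, seat `prim-gen-swap` (gen 5); memo TWO-PORT-PEELING.md §6.  For a configuration `ω` in which the two hubs `u, v ∉ A`
have no open pair, the events of the comonotone certificate — loneliness of `c, a, b`, the observer events of `u`, and the CS₂ pair events, read in
`ω`, in `ω ∪ star(u)`, in `ω ∪ star(v)` and in `ω ∪ star(u) ∪ star(v)` — are expressed through nine elementary properties of `ω`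
(`|π(c)| ≤ j`, `|π(a)| ≤ j`, `|π(b)| ≤ j`, `|π(a) ∪ π(a')| ≤ j`, `|π(b) ∪ π(b')| ≤ j`, and the four attachment relations), when `j ≤ 2`.
No definitions, no named facts, no sorries.
-/

noncomputable section

namespace Summit.CriticalPhenomena.PercolationContinuityZ3.Theorems

open MeasureTheory Set Literature.Probability.LatticeModels Literature.Probability.Percolation
open scoped Classical BigOperators

variable {n : ℕ}

namespace TwoPortPeeling

/-- An isolated vertex is reached by nobody else. [folklore] -/
theorem not_reachable_to_isolated (ω : BondConfig (Fin n)) {u x : Fin n} (hx : x ≠ u)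
    (hiso : ∀ y : Fin n, y ≠ u → s(u, y) ∉ ω) : ¬ (openGraph ω).Reachable x u := by
  intro ⟨wk⟩
  cases wk.reverse with
  | nil => exact hx rfl
  | cons hadj _ =>
    rw [openGraph_adj] at hadj
    exact hiso _ (fun h => hadj.2 h.symm) hadj.1

/-- The relay set of an isolated non-relay vertex is empty. [folklore] -/
theorem filter_isolated_eq_empty (A : Finset (Fin n)) (ω : BondConfig (Fin n)) {u : Fin n} (hu : u ∉ A)
    (hiso : ∀ y : Fin n, y ≠ u → s(u, y) ∉ ω) : (A.filter fun z => ω ∈ openConn u z) = ∅ := by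
  refine Finset.filter_eq_empty_iff.2 fun z hz h => ?_
  have hzu : z ≠ u := fun h' => hu (h' ▸ hz)
  exact not_reachable_to_isolated ω hzu hiso (h : (openGraph ω).Reachable u z).symm

/-- Inserting pairs at `v` keeps `u ≠ v` isolated (if the inserted pairs avoid `u`). [folklore] -/
theorem isolated_insert_hub (ω : BondConfig (Fin n)) {u v b b' : Fin n} (huv : u ≠ v) (hub : u ≠ b) (hub' : u ≠ b')
    (hiso : ∀ y : Fin n, y ≠ u → s(u, y) ∉ ω) :
    ∀ y : Fin n, y ≠ u → s(u, y) ∉ insert s(v, b) (insert s(v, b') ω) := by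
  intro y hyu h
  rcases Set.mem_insert_iff.1 h with h | h
  · rw [Sym2.eq_iff] at h
    rcases h with ⟨h1, -⟩ | ⟨h1, -⟩
    · exact huv h1
    · exact hub h1
  · rcases Set.mem_insert_iff.1 h with h | h
    · rw [Sym2.eq_iff] at h
      rcases h with ⟨h1, -⟩ | ⟨h1, -⟩
      · exact huv h1
      · exact hub' h1
    · exact hiso y hyu h

/-- The observer event of the glued hub: `|π(u)|` in `ω ∪ star(u)` is `|π(a) ∪ π(a')|`. [this file] -/
theorem filter_hub_center (A : Finset (Fin n)) (ω : BondConfig (Fin n)) {u a a' : Fin n} (hu : u ∉ A)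
    (hua : u ≠ a) (hua' : u ≠ a') (hiso : ∀ y : Fin n, y ≠ u → s(u, y) ∉ ω) :
    (A.filter fun z => insert s(u, a) (insert s(u, a') ω) ∈ openConn u z) =
      (A.filter fun z => ω ∈ openConn a z) ∪ (A.filter fun z => ω ∈ openConn a' z) := by
  ext z
  rw [Finset.mem_union, Finset.mem_filter, Finset.mem_filter, Finset.mem_filter]
  constructor
  · rintro ⟨hz, h⟩
    have hzu : z ≠ u := fun h' => hu (h' ▸ hz)
    have h' := (reachable_hub_center_iff ω hua hua' hiso hzu).1 (h : (openGraph _).Reachable u z).symm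
    rcases h' with h' | h'
    · exact Or.inl ⟨hz, h'.symm⟩
    · exact Or.inr ⟨hz, h'.symm⟩
  · rintro (⟨hz, h⟩ | ⟨hz, h⟩)
    · have hzu : z ≠ u := fun h' => hu (h' ▸ hz)
      exact ⟨hz, ((reachable_hub_center_iff ω hua hua' hiso hzu).2 (Or.inl (h : (openGraph ω).Reachable a z).symm)).symm⟩
    · have hzu : z ≠ u := fun h' => hu (h' ▸ hz)
      exact ⟨hz, ((reachable_hub_center_iff ω hua hua' hiso hzu).2 (Or.inr (h : (openGraph ω).Reachable a' z).symm)).symm⟩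

/-- Three distinct members bound a finset's cardinality from below. [folklore] -/
theorem three_le_card_of_mem {s : Finset (Fin n)} {x y z : Fin n} (hx : x ∈ s) (hy : y ∈ s) (hz : z ∈ s)
    (hxy : x ≠ y) (hxz : x ≠ z) (hyz : y ≠ z) : 3 ≤ s.card := by
  have hsub : ({x, y, z} : Finset (Fin n)) ⊆ s := by
    intro t ht
    simp only [Finset.mem_insert, Finset.mem_singleton] at ht
    rcases ht with rfl | rfl | rfl
    · exact hx
    · exact hy
    · exact hz
  have hcard : ({x, y, z} : Finset (Fin n)).card = 3 := by
    rw [Finset.card_eq_three]; exact ⟨x, y, z, hxy, hxz, hyz, rfl⟩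
  exact hcard ▸ Finset.card_le_card hsub

/-- **Small glued pair ⇒ no attachment (level ≤ 2).**  If `|π(a) ∪ π(a')| ≤ j ≤ 2` (`a ≠ a'` relays) then every `z ∈ π(a) ∪ π(a')` is `a` or `a'`;
in particular a third relay `x` is joined to neither. [this file] -/
theorem not_reachable_of_small_pair (A : Finset (Fin n)) (ω : BondConfig (Fin n)) {a a' x : Fin n} (j : ℕ) (hj : j ≤ 2)
    (ha : a ∈ A) (ha' : a' ∈ A) (hx : x ∈ A) (haa' : a ≠ a') (hxa : x ≠ a) (hxa' : x ≠ a')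
    (hsmall : ((A.filter fun z => ω ∈ openConn a z) ∪ (A.filter fun z => ω ∈ openConn a' z)).card ≤ j) :
    ¬ (openGraph ω).Reachable x a ∧ ¬ (openGraph ω).Reachable x a' := by
  have hmem_a : a ∈ (A.filter fun z => ω ∈ openConn a z) ∪ (A.filter fun z => ω ∈ openConn a' z) :=
    Finset.mem_union.2 (Or.inl (Finset.mem_filter.2 ⟨ha, (SimpleGraph.Reachable.refl _ : (openGraph ω).Reachable a a)⟩))
  have hmem_a' : a' ∈ (A.filter fun z => ω ∈ openConn a z) ∪ (A.filter fun z => ω ∈ openConn a' z) :=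
    Finset.mem_union.2 (Or.inr (Finset.mem_filter.2 ⟨ha', (SimpleGraph.Reachable.refl _ : (openGraph ω).Reachable a' a')⟩))
  constructor
  · intro h
    have hmem_x : x ∈ (A.filter fun z => ω ∈ openConn a z) ∪ (A.filter fun z => ω ∈ openConn a' z) :=
      Finset.mem_union.2 (Or.inl (Finset.mem_filter.2 ⟨hx, h.symm⟩))
    have := three_le_card_of_mem hmem_x hmem_a hmem_a' hxa hxa' haa'
    omega
  · intro h
    have hmem_x : x ∈ (A.filter fun z => ω ∈ openConn a z) ∪ (A.filter fun z => ω ∈ openConn a' z) :=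
      Finset.mem_union.2 (Or.inr (Finset.mem_filter.2 ⟨hx, h.symm⟩))
    have := three_le_card_of_mem hmem_x hmem_a hmem_a' hxa hxa' haa'
    omega

/-- **Loneliness of a third vertex after gluing through an isolated hub (level ≤ 2).**  For `x ∈ A ∖ {a,a'}`:
`|π'(x)| ≤ j` in `ω ∪ star(u)` iff `x` is joined to neither `a` nor `a'` and `|π(x)| ≤ j` in `ω`. [this file] -/
theorem small_hub_iff (A : Finset (Fin n)) (ω : BondConfig (Fin n)) {u a a' x : Fin n} (j : ℕ) (hj : j ≤ 2) (hu : u ∉ A)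
    (ha : a ∈ A) (ha' : a' ∈ A) (hx : x ∈ A) (haa' : a ≠ a') (hxa : x ≠ a) (hxa' : x ≠ a')
    (hiso : ∀ y : Fin n, y ≠ u → s(u, y) ∉ ω) :
    (A.filter fun z => insert s(u, a) (insert s(u, a') ω) ∈ openConn x z).card ≤ j ↔
      (¬ ((openGraph ω).Reachable x a ∨ (openGraph ω).Reachable x a') ∧ (A.filter fun z => ω ∈ openConn x z).card ≤ j) := by
  have hua : u ≠ a := fun h => hu (h ▸ ha)
  have hua' : u ≠ a' := fun h => hu (h ▸ ha')
  have hxu : x ≠ u := fun h => hu (h ▸ hx)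
  by_cases hatt : (openGraph ω).Reachable x a ∨ (openGraph ω).Reachable x a'
  · have h3 := three_le_card_hub A ω hu ha ha' hx haa' hxa hxa' hiso hatt
    constructor
    · intro h; omega
    · rintro ⟨h, -⟩; exact absurd hatt h
  · rw [filter_hub_eq_of_not A ω hu hua hua' hxu hiso (fun h => hatt (Or.inl h)) (fun h => hatt (Or.inr h))]
    exact ⟨fun h => ⟨hatt, h⟩, fun h => h.2⟩

/-- **Loneliness of the glued relay (level ≤ 2).**  `|π'(a)| ≤ j` in `ω ∪ star(u)` iff `|π(a) ∪ π(a')| ≤ j`. [this file] -/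
theorem small_hub_self_iff (A : Finset (Fin n)) (ω : BondConfig (Fin n)) {u a a' : Fin n} (j : ℕ) (hu : u ∉ A)
    (ha : a ∈ A) (hua' : u ≠ a') (hiso : ∀ y : Fin n, y ≠ u → s(u, y) ∉ ω) :
    (A.filter fun z => insert s(u, a) (insert s(u, a') ω) ∈ openConn a z).card ≤ j ↔
      ((A.filter fun z => ω ∈ openConn a z) ∪ (A.filter fun z => ω ∈ openConn a' z)).card ≤ j := by
  rw [filter_hub_self A ω hu ha hua' hiso]

/-- **The hub's observer event (level ≤ 2).**  `1 ≤ |π'(u)| ≤ j` in `ω ∪ star(u)` iff `|π(a) ∪ π(a')| ≤ j`. [this file] -/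
theorem small_hub_center_iff (A : Finset (Fin n)) (ω : BondConfig (Fin n)) {u a a' : Fin n} (j : ℕ) (hu : u ∉ A)
    (ha : a ∈ A) (hua : u ≠ a) (hua' : u ≠ a') (hiso : ∀ y : Fin n, y ≠ u → s(u, y) ∉ ω) :
    (1 ≤ (A.filter fun z => insert s(u, a) (insert s(u, a') ω) ∈ openConn u z).card ∧
      (A.filter fun z => insert s(u, a) (insert s(u, a') ω) ∈ openConn u z).card ≤ j) ↔
      ((A.filter fun z => ω ∈ openConn a z) ∪ (A.filter fun z => ω ∈ openConn a' z)).card ≤ j := by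
  rw [filter_hub_center A ω hu hua hua' hiso]
  constructor
  · exact fun h => h.2
  · intro h
    refine ⟨Finset.card_pos.2 ⟨a, Finset.mem_union.2 (Or.inl (Finset.mem_filter.2 ⟨ha, ?_⟩))⟩, h⟩
    exact (SimpleGraph.Reachable.refl _ : (openGraph ω).Reachable a a)

end TwoPortPeeling

end Summit.CriticalPhenomena.PercolationContinuityZ3.Theorems

end
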